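import Mathlib
import Summits.ResolutionOfSingularities.ResolutionOfSingularities.Theorems.WildQuotientsWildQuotientResolutionCubeZeroNormalForm

/-!
# PRIZE modulo V3: every LINEAR `ℤ/3`-quotient `𝔸ⁿ/σ`, `n ≤ 4`, `char k = 3`, has a resolution —
# given the rung V3 (the Jordan block `J₃` with passengers at `p = 3`)

(crux stmt-ResolutionOfSingularities-15640 `WildQuotients.WildQuotientResolution`, line `Sketch`,
sector `|G| = p`; helper toward the registered stub `linearCyclicQuotient_hasResolution_charThree`
(PRIZE of `L/w45c/W45cPlanSignaturesV4.lean` §D), in the `_of_v3` form allowed by CHAIN v4 §4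
(pattern `TwoBlocks.twoJordanBlocksFourfold_hasResolution_of_model`, p467757): the V3 final
`v3_hasResolution_charThree` (registered stub, §B) is taken as the hypothesis `hV3`, stated
VERBATIM and universally in `n, σ, a, b, c`. [OURS · L1 W4.5c] — NOT a statement of any
manuscript. Prover res-L1-w45c-stub-4.)

* `cube_sub_of_order_three` — in characteristic `3`, `σ³ = 1` on a coordinate gives
  `(σ − 1)³ = 0` there (`(σ − 1)³ = σ³ − 1 − 3σ(σ − 1)`).
* `linearCyclicQuotient_hasResolution_charThree_of_v3` — PRIZE modulo V3: JNF-3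
  (`LinearCubeZero.exists_conj_normalForm_of_cube_zero`) splits a linear `σ` of order `3`, `n ≤ 4`,
  into an LSB conjugate (rung LSB `LinearSmallBlocks.hasResolution`, p471938) or a `J₃` conjugate
  (`hV3`), and `TameTransfer.hasResolution_fixedPoints_zpowers_conj` (p471072) transports back.
-/

-- single-problem summit: the doubled namespace component `ResolutionOfSingularities` is forced
set_option linter.dupNamespace false

noncomputable section

open Module MvPolynomial AlgebraicGeometry CategoryTheory Literature.AlgebraicGeometry.Resolution

namespace Summit.ResolutionOfSingularities.ResolutionOfSingularities.Theorems.WildQuotientResolution.LinearCubeZero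

/-- In characteristic `3`, `σ (σ (σ x)) = x` implies `(σ − 1)³ x = 0`, written as
`σ ((σ − 1)² x) = (σ − 1)² x` (`(σ − 1)³ = σ³ − 3σ² + 3σ − 1 = σ³ − 1`). [folklore] -/
theorem cube_sub_of_order_three (k : Type) [Field k] [CharP k 3] (n : ℕ)
    (σ : MvPolynomial (Fin n) k ≃ₐ[k] MvPolynomial (Fin n) k) (x : MvPolynomial (Fin n) k)
    (hord : σ (σ (σ x)) = x) :
    σ (σ (σ x - x) - (σ x - x)) = σ (σ x - x) - (σ x - x) := by
  have h3 : (3 : MvPolynomial (Fin n) k) = 0 := by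
    have h := CharP.cast_eq_zero (MvPolynomial (Fin n) k) 3
    exact_mod_cast h
  simp only [map_sub, hord]
  linear_combination (σ x - σ (σ x)) * h3

/-- **PRIZE modulo V3** (helper; the registered PRIZE `linearCyclicQuotient_hasResolution_charThree`
follows by instantiating `hV3` with the V3 final `v3_hasResolution_charThree` once it lands): every
LINEAR `σ` of `k[x₁,…,xₙ]`, `n ≤ 4`, `char k = 3`, with `σ³ = 1` on the coordinates has a
resolvable quotient `Spec k[x]^⟨σ⟩` — GIVEN the rung V3 for every `J₃`-with-passengers datum.
Cases by JNF-3: LSB conjugate ⇒ `LinearSmallBlocks.hasResolution` (p471938); `J₃` conjugate ⇒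
`hV3`; both transported back along `τ⁻¹` by `TameTransfer.hasResolution_fixedPoints_zpowers_conj`
(p471072). [OURS · L1 W4.5c] -/
theorem linearCyclicQuotient_hasResolution_charThree_of_v3 (k : Type) [Field k] [CharP k 3]
    (hV3 : ∀ (n : ℕ) (σ : MvPolynomial (Fin n) k ≃ₐ[k] MvPolynomial (Fin n) k) (a b c : Fin n),
      a ≠ b → b ≠ c → a ≠ c → σ (X b) = X b + X a → σ (X c) = X c + X b →
      (∀ i, i ≠ b → i ≠ c → σ (X i) = X i) →
      Scheme.HasResolution
        (Spec (.of (FixedPoints.subalgebra k (MvPolynomial (Fin n) k) (Subgroup.zpowers σ)))))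
    (n : ℕ) (hn : n ≤ 4) (σ : MvPolynomial (Fin n) k ≃ₐ[k] MvPolynomial (Fin n) k)
    (hlin : ∀ i, σ (X i) ∈ Submodule.span k (Set.range (X : Fin n → MvPolynomial (Fin n) k)))
    (hord : ∀ i, σ (σ (σ (X i))) = X i) :
    Scheme.HasResolution
      (Spec (.of (FixedPoints.subalgebra k (MvPolynomial (Fin n) k) (Subgroup.zpowers σ)))) := by
  have hcube := fun i => cube_sub_of_order_three k n σ (X i) (hord i)
  obtain ⟨τ, h⟩ := exists_conj_normalForm_of_cube_zero k n hn σ hlin hcube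
  have e : τ⁻¹ * (τ * σ * τ⁻¹) * τ⁻¹⁻¹ = σ := by group
  rcases h with ⟨D, f, hfD, hD, hoff⟩ | ⟨a, b, c, hab, hbc, hac, hb, hc, hrest⟩
  · have h := LinearSmallBlocks.hasResolution 3 (by norm_num) k n (τ * σ * τ⁻¹) D f hfD hD hoff
    have h' := TameTransfer.hasResolution_fixedPoints_zpowers_conj (τ * σ * τ⁻¹) τ⁻¹ h
    rw [e] at h'
    exact h'
  · have h := hV3 n (τ * σ * τ⁻¹) a b c hab hbc hac hb hc hrest
    have h' := TameTransfer.hasResolution_fixedPoints_zpowers_conj (τ * σ * τ⁻¹) τ⁻¹ h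
    rw [e] at h'
    exact h'

end Summit.ResolutionOfSingularities.ResolutionOfSingularities.Theorems.WildQuotientResolution.LinearCubeZero

end
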